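import Literature.Geometry.Kaehler.ComplexTorusCyclotomicCharpolyHodgeClassesDegreeLeEight
import Literature.NumberTheory.Automorphic.Arthur2013.Leaves.TorusCyclotomic
import HarnessLib

/-!
# The CM types of the cyclotomic fields of degree `8` (`ℚ(ζ_d)`, `φ(d) = 8`): nondegenerate ⟺ primitive ⟺ rank `5`;
# every abelian variety of a primitive type is a simple fourfold satisfying the Hodge conjecture with all its powers

Layer `Literature/Geometry/Kaehler`, namespace `Literature.Geometry.Kaehler.ComplexTorus`; lane `lit-hodgefound` (Track 2
foundations library), prover seat `lit-hodgefound-p10`, generation 33, row «A2-26(hc)» (self-proposed 2026-08-28) — the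
variety-side companion of the capstone `…CharpolyHodgeClassesDegreeLeEight`.  Theorems only; no `def`, no instance, no named fact
(net Literature debt 0).

`φ(d) = 8 ⟺ d ∈ {15, 16, 20, 24, 30}` (`eq_of_totient_eq_eight`), and `ℚ(ζ₃₀) = ℚ(ζ₁₅)` (the tree's
`isCyclotomicExtension_of_two_mul_of_odd`); so a statement about «a CM type of `ℚ(ζ_d)`, `φ(d) = 8`» is the conjunction of the
four statements of this generation's `…OrderSixteenHodge` (`d = 16`), `…CharpolyFifteenHodge` (`d = 15, 30`),
`…CharpolyTwentyHodge` (`d = 20`), `…CharpolyTwentyFourHodge` (`d = 24`), each proved there from an explicit `5 × 5` rank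
certificate for the primitive types and the induced-type formula for the imprimitive ones.  Uniformly in `d`:

* **`isNondegenerate_iff_isPrimitive_of_totient_eq_eight`**, **`cmTypeRank_eq_five_iff_isPrimitive_of_totient_eq_eight`**: a CM
  type of `ℚ(ζ_d)`, `φ(d) = 8`, is nondegenerate (Kubota rank `n + 1 = 5`) iff it is primitive — Dodson's theorem «a simple CM
  fourfold is degenerate only when `Gal(Kᶜ/ℚ) = ℤ₂ × A₄` or `ℤ₂ × S₄`» in the abelian (cyclotomic) case, by direct count.
* `dim_eq_four_of_isCMTypeRealisation_of_totient_eq_eight`, **`isSimple_and_hodgeConjectureFor_pow_of_isPrimitive_of_totient_eq_eight`**,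
  `hodgeConjectureFor_of_isPrimitive_of_totient_eq_eight`, **`exists_isSimple_hodgeConjectureFor_pow_of_totient_eq_eight`**: every
  abelian variety of a primitive CM type of a cyclotomic field of degree `8` is a SIMPLE abelian fourfold with
  `B•(Aⁿ) ⊗ ℂ = D•(Aⁿ) ⊗ ℂ` and the Hodge conjecture for ALL powers `Aⁿ`, UNCONDITIONALLY; and such varieties exist for each of
  the four fields.

## References

* [Dodson1984] B. Dodson, *The structure of Galois groups of CM-fields*, Trans. AMS 283 (1984), §3.1.0 p. 11, §3.3.2 Theorem p. 16.
* [Kubota1965] T. Kubota, *On the field extension by complex multiplication*, Trans. AMS 118 (1965), §2 p. 115.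
* [Gordon1999HodgeAVSurvey] B. B. Gordon, *A survey of the Hodge conjecture for abelian varieties* (1999), Thm. 6.4, §9.3.
* [Shimura1998] G. Shimura, *Abelian Varieties with Complex Multiplication and Modular Functions* (1998), §6.2 Thm. 3,
  §8.2 Prop. 26, §8.4 Examples (1)–(2).
* [Washington1997] L. C. Washington, *Introduction to Cyclotomic Fields*, 2nd ed. (1997), Ch. 2 (`ℚ(ζ_{2m}) = ℚ(ζ_m)`, `m` odd).
-/

noncomputable section

open scoped Classical nonZeroDivisors NumberField
open NumberField Module CategoryTheory CategoryTheory.Limits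

namespace Literature.Geometry.Kaehler

namespace ComplexTorus

-- `open scoped`: the tree's action of `Aut(ℂ)` on `Hom(K, ℂ)` by composition (`ringEquivCompAction`) is a scoped instance
open scoped Literature.NumberTheory.ComplexMultiplication
open Literature.AlgebraicGeometry.Motives (CMType AbelianVariety)
open Literature.AlgebraicGeometry.HodgeTheory (HodgeConjectureFor complexBetti)
open Literature.AlgebraicGeometry.VanGeemen1994 (hodgeClassSpan)
open Literature.Barriers.HodgeConjecture (divisorClassesSpan)
open Literature.NumberTheory.ComplexMultiplication (IsPrimitive)
open Literature.AlgebraicGeometry.Pohlmann1968 (cmTypeRank IsNondegenerate)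
open Literature.AlgebraicGeometry.ComplexMultiplication (IsCMTypeRealisation)
open Literature.NumberTheory.Automorphic.Arthur2013.Leaves.TECR.TorusDict (isCyclotomicExtension_of_two_mul_of_odd)

variable {d : ℕ} {K : Type} [Field K] [NumberField K]
  {A : AbelianVariety ℂ} {ι : 𝓞 K →+* End A} {θ : K →+* Module.End ℂ (complexBetti A.X 1)}

/-- `ℚ(ζ₃₀) = ℚ(ζ₁₅)`: an `IsCyclotomicExtension {30} ℚ K` is an `IsCyclotomicExtension {15} ℚ K` (the tree's
`isCyclotomicExtension_of_two_mul_of_odd`). [cite: Washington1997, Ch. 2] [folklore] -/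
theorem isCyclotomicExtension_fifteen_of_thirty (hK : IsCyclotomicExtension {30} ℚ K) : IsCyclotomicExtension {15} ℚ K := by
  haveI : IsCyclotomicExtension {2 * 15} ℚ K := hK
  exact isCyclotomicExtension_of_two_mul_of_odd (K := K) (by decide)

/-- **NONDEGENERATE ⟺ PRIMITIVE for the CM types of every cyclotomic field of degree `8`** (`ℚ(ζ_d)`, `φ(d) = 8`).
[cite: Dodson1984, §3.3.2 Theorem (p. 16)] [cite: Shimura1998, §8.4 Examples (1)–(2)] -/
theorem isNondegenerate_iff_isPrimitive_of_totient_eq_eight (hK : IsCyclotomicExtension {d} ℚ K) (h8 : Nat.totient d = 8)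
    (Φ : CMType K) (φ₀ : K →+* ℂ) : IsNondegenerate Φ ↔ IsPrimitive (ℂ ≃+* ℂ) Φ.1 φ₀ := by
  rcases eq_of_totient_eq_eight h8 with rfl | rfl | rfl | rfl | rfl
  · exact isNondegenerate_iff_isPrimitive_fifteen hK Φ φ₀
  · haveI := hK; exact isNondegenerate_iff_isPrimitive_sixteen Φ φ₀
  · exact isNondegenerate_iff_isPrimitive_twenty hK Φ φ₀
  · exact isNondegenerate_iff_isPrimitive_twentyFour hK Φ φ₀
  · exact isNondegenerate_iff_isPrimitive_fifteen (isCyclotomicExtension_fifteen_of_thirty hK) Φ φ₀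

/-- **`Rank(Φ) = 5 ⟺ Φ` PRIMITIVE** for the CM types of every cyclotomic field of degree `8` (Kubota's `n + 1` with `n = 4`).
[cite: Dodson1984, §3.1.0 (p. 11), §3.3.2 Theorem (p. 16)] [cite: Kubota1965, §2 (p. 115)] -/
theorem cmTypeRank_eq_five_iff_isPrimitive_of_totient_eq_eight (hK : IsCyclotomicExtension {d} ℚ K) (h8 : Nat.totient d = 8)
    (Φ : CMType K) (φ₀ : K →+* ℂ) : cmTypeRank Φ = 5 ↔ IsPrimitive (ℂ ≃+* ℂ) Φ.1 φ₀ := by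
  rcases eq_of_totient_eq_eight h8 with rfl | rfl | rfl | rfl | rfl
  · exact cmTypeRank_eq_five_iff_isPrimitive_fifteen hK Φ φ₀
  · haveI := hK; exact cmTypeRank_eq_five_iff_isPrimitive_sixteen Φ φ₀
  · exact cmTypeRank_eq_five_iff_isPrimitive_twenty hK Φ φ₀
  · exact cmTypeRank_eq_five_iff_isPrimitive_twentyFour hK Φ φ₀
  · exact cmTypeRank_eq_five_iff_isPrimitive_fifteen (isCyclotomicExtension_fifteen_of_thirty hK) Φ φ₀

/-- `dim A = 4` for a realisation of a CM type of a cyclotomic field of degree `8`. [cite: Shimura1998, §6.2 Thm. 3] -/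
theorem dim_eq_four_of_isCMTypeRealisation_of_totient_eq_eight (hK : IsCyclotomicExtension {d} ℚ K) (h8 : Nat.totient d = 8)
    {Φ : CMType K} (hA : IsCMTypeRealisation Φ A ι θ) : A.dim = 4 := by
  rcases eq_of_totient_eq_eight h8 with rfl | rfl | rfl | rfl | rfl
  · exact dim_eq_four_of_isCMTypeRealisation_fifteen hK hA
  · haveI := hK; exact dim_eq_four_of_isCMTypeRealisation_sixteen hA
  · exact dim_eq_four_of_isCMTypeRealisation_twenty hK hA
  · exact dim_eq_four_of_isCMTypeRealisation_twentyFour hK hA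
  · exact dim_eq_four_of_isCMTypeRealisation_fifteen (isCyclotomicExtension_fifteen_of_thirty hK) hA

/-- **EVERY ABELIAN VARIETY OF A PRIMITIVE CM TYPE OF A CYCLOTOMIC FIELD OF DEGREE `8` IS A SIMPLE FOURFOLD WITH
`B•(Aⁿ) ⊗ ℂ = D•(Aⁿ) ⊗ ℂ` AND THE HODGE CONJECTURE FOR ALL ITS POWERS**, unconditionally (`ℚ(ζ₁₅) = ℚ(ζ₃₀)`, `ℚ(ζ₁₆)`, `ℚ(ζ₂₀)`,
`ℚ(ζ₂₄)`). [cite: Dodson1984, §3.3.2 Theorem (p. 16)] [cite: Gordon1999HodgeAVSurvey, Thm. 6.4 and §9.3] [cite: Shimura1998, §8.2 Prop. 26] -/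
theorem isSimple_and_hodgeConjectureFor_pow_of_isPrimitive_of_totient_eq_eight (hK : IsCyclotomicExtension {d} ℚ K)
    (h8 : Nat.totient d = 8) (Φ : CMType K) (φ₀ : K →+* ℂ) (hΦ : IsPrimitive (ℂ ≃+* ℂ) Φ.1 φ₀)
    (hA : IsCMTypeRealisation Φ A ι θ) (n k : ℕ) :
    A.IsSimple ∧
      hodgeClassSpan (⨁ fun _ : Fin n => A).dim (⨁ fun _ : Fin n => A).X k =
        divisorClassesSpan (⨁ fun _ : Fin n => A).X (⨁ fun _ : Fin n => A).dim k ∧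
      HodgeConjectureFor (⨁ fun _ : Fin n => A).dim (⨁ fun _ : Fin n => A).X := by
  rcases eq_of_totient_eq_eight h8 with rfl | rfl | rfl | rfl | rfl
  · exact isSimple_and_hodgeConjectureFor_pow_of_isPrimitive_fifteen hK Φ φ₀ hΦ hA n k
  · haveI := hK; exact isSimple_and_hodgeConjectureFor_pow_of_isPrimitive_sixteen Φ φ₀ hΦ hA n k
  · exact isSimple_and_hodgeConjectureFor_pow_of_isPrimitive_twenty hK Φ φ₀ hΦ hA n k
  · exact isSimple_and_hodgeConjectureFor_pow_of_isPrimitive_twentyFour hK Φ φ₀ hΦ hA n k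
  · exact isSimple_and_hodgeConjectureFor_pow_of_isPrimitive_fifteen (isCyclotomicExtension_fifteen_of_thirty hK) Φ φ₀ hΦ
      hA n k

/-- **The Hodge conjecture for every abelian variety of a primitive CM type of a cyclotomic field of degree `8`.**
[cite: Dodson1984, §3.3.2 Theorem (p. 16)] [cite: Gordon1999HodgeAVSurvey, Thm. 6.4 and §9.3] -/
theorem hodgeConjectureFor_of_isPrimitive_of_totient_eq_eight (hK : IsCyclotomicExtension {d} ℚ K) (h8 : Nat.totient d = 8)
    (Φ : CMType K) (φ₀ : K →+* ℂ) (hΦ : IsPrimitive (ℂ ≃+* ℂ) Φ.1 φ₀) (hA : IsCMTypeRealisation Φ A ι θ) :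
    HodgeConjectureFor A.dim A.X := by
  rcases eq_of_totient_eq_eight h8 with rfl | rfl | rfl | rfl | rfl
  · exact hodgeConjectureFor_of_isPrimitive_fifteen hK Φ φ₀ hΦ hA
  · haveI := hK; exact hodgeConjectureFor_of_isPrimitive_sixteen Φ φ₀ hΦ hA
  · exact hodgeConjectureFor_of_isPrimitive_twenty hK Φ φ₀ hΦ hA
  · exact hodgeConjectureFor_of_isPrimitive_twentyFour hK Φ φ₀ hΦ hA
  · exact hodgeConjectureFor_of_isPrimitive_fifteen (isCyclotomicExtension_fifteen_of_thirty hK) Φ φ₀ hΦ hA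

variable (K) in
/-- **For each cyclotomic field of degree `8` there is a SIMPLE abelian fourfold of (primitive) CM type by it satisfying, with all
its powers, the Hodge conjecture.** [cite: Dodson1984, §3.3.2 Theorem (p. 16)] [cite: Gordon1999HodgeAVSurvey, Thm. 6.4 and §9.3]
[cite: Shimura1998, §8.4 Examples (1)–(2)] -/
theorem exists_isSimple_hodgeConjectureFor_pow_of_totient_eq_eight (hK : IsCyclotomicExtension {d} ℚ K) (h8 : Nat.totient d = 8) :
    ∃ (Φ : CMType K) (A : AbelianVariety ℂ) (ι' : 𝓞 K →+* End A) (θ' : K →+* Module.End ℂ (complexBetti A.X 1)),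
      IsCMTypeRealisation Φ A ι' θ' ∧ A.IsSimple ∧ A.dim = 4 ∧
        ∀ n : ℕ, HodgeConjectureFor (⨁ fun _ : Fin n => A).dim (⨁ fun _ : Fin n => A).X := by
  rcases eq_of_totient_eq_eight h8 with rfl | rfl | rfl | rfl | rfl
  · exact exists_isSimple_hodgeConjectureFor_pow_fifteen K hK
  · haveI := hK; exact exists_isSimple_hodgeConjectureFor_pow_sixteen K
  · exact exists_isSimple_hodgeConjectureFor_pow_twenty K hK
  · exact exists_isSimple_hodgeConjectureFor_pow_twentyFour K hK
  · exact exists_isSimple_hodgeConjectureFor_pow_fifteen K (isCyclotomicExtension_fifteen_of_thirty hK)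

end ComplexTorus

end Literature.Geometry.Kaehler

end
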